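import Mathlib
import HarnessLib
import Literature.Analysis.FluidPDE.ClassicalSolution
import Literature.Analysis.FluidPDE.ClassicalSolutionCalculus
import Literature.Analysis.FluidPDE.LerayHopf
import Literature.Analysis.FluidPDE.SuitableWeak
import Summits.NavierStokesRegularity.NavierStokesRegularity.Theorems.QuarterJoltL4SliceTestCriterion
import Summits.NavierStokesRegularity.NavierStokesRegularity.Theorems.QuarterJoltWeakL4EnergyEquality
import Summits.NavierStokesRegularity.NavierStokesRegularity.Theorems.CertifiedBlowupCertifiedBlowupAxisymBlowupEnergyDrain

/-!
# Route QuarterJolt — crux `NoTerminalJolt` (stmt-NavierStokesRegularity-26463), LEAD line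
# `regular_split` rev 8: THE WEAK-`L²`-IN-TIME MAJORANT CRITERION — `‖u(·)‖²_{L⁴}` DOMINATED BY AN
# `L^{2,w}(t₀,T)` FUNCTION FORCES THE ENERGY EQUALITY AT `T`

Seat ns-ntj-p1 g6 (LEAD of the crux; `--supports 26463 --as helper`). Fifth file of the `L⁴`
SLICE-TEST CRITERION chain (after p652191, p652789, p653319, p654094). Frame: `(u,p)` classical on
`[0,T)` (`ν, T > 0`), Leray–Hopf on `[0,T]` from a rapidly decaying datum.

1. `lintegral_ofReal_le_of_weakL2` — WEAK-`L²` TAIL BOUND (layer cake): for `f` a.e.-measurable on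
   `(a,b)` with `|{τ ∈ (a,b) : f(τ) > λ}| ≤ (N/λ)²` for all `λ > 0`, `∫ₐᵇ f⁺ ≤ 2N√(b−a)`
   (`∫⁻ ofReal f = ∫₀^∞ |{f > λ}| dλ ≤ ∫₀^{λ₀}(b−a) + ∫_{λ₀}^∞ N²/λ²`, `λ₀ = N/√(b−a)`).
2. `tendsto_integral_norm_sub_sq_of_weakL2Majorant` — THE CRITERION: if `‖u(τ)‖²_{L⁴} ≤ m(τ)`
   for `τ < T` near `T` with `m` measurable and `m ∈ L^{2,w}(t₀,T)` in the above sense, then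
   `∫‖u(t) − u(T)‖² → 0` as `t ↑ T` (the tail bound gives `∫ₜˢ m ≤ 2N√(T−t)`, i.e. the `L⁴`
   slice-test criterion in majorant form, `tendsto_integral_norm_sub_sq_of_l4Majorant` p652789).
3. `tendsto_integral_norm_sub_sq_of_weakL4L4` — **`‖u(·)‖_{L⁴} ∈ L^{4,w}(t₀,T)` ⇒ ENERGY EQUALITY
   AT `T`**: `|{τ ∈ (t₀,T) : ∫‖u(τ)‖⁴ > λ}| ≤ N/λ` for all `λ > 0` suffices. This is the
   `β = p = 4` corner of Cheskidov–Luo, Nonlinearity 33 (2020) Thm. 1.1 (`u ∈ L^{β,w}B^{2/β+2/p−1}_{p,∞}`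
   for `1 ≤ β < p`, `2/p + 1/β < 1`), which their hypothesis `β < p` EXCLUDES; it contains Lions'
   `L⁴L⁴` (strong), the weak-`L⁴` rate `∫‖u(t)‖⁴ ≤ M/(T−t)` (p653319) and every INTERMITTENT version
   of it (the rate holding only in measure), at a first blow-up time of the frame.
4. `tendsto_integral_norm_sub_sq_of_weakL2Linfty` — **intermittent Type I**: a measurable
   sup-norm majorant `‖u(τ,x)‖ ≤ b(τ)` with `b ∈ L^{2,w}(t₀,T)` (`|{b > λ}| ≤ (N/λ)²`) forces the
   energy equality at `T` (Cheskidov–Luo Thm. 1.1 at `p = ∞`, `β = 2`: `L^{2,w}B⁰_{∞,∞}`, in the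
   frame with `L^∞ ⊂ B⁰_{∞,∞}`); the Type-I rate `b = C/√(T−t)` (Leslie–Shvydkoy 2018 Thm. 1.2,
   rev 5) is its non-intermittent member.
5. `tendsto_integral_norm_sub_sq_of_L2Linfty` — the strong endpoint `L²(t₀,T; L^∞)` (Shinbrot
   `p = ∞`; inside Kozono–Taniuchi's `L²BMO`), by Chebyshev from 4.

HONEST FRAMING: conditional energy-equality criteria at a first blow-up time; nothing here claims
progress on `NoTerminalJolt`, stmt-18118 or Navier–Stokes regularity — all OPEN. No summit
statement is proved here. [folklore]
-/

noncomputable section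

-- the summit and its single sub-problem share the name (CONVENTIONS §1), as in every Theorems file
set_option linter.dupNamespace false

namespace Summit.NavierStokesRegularity.NavierStokesRegularity.Theorems

open MeasureTheory Set Function Filter Topology InnerProductSpace
open scoped ENNReal NNReal ContDiff RealInnerProductSpace
open Literature.Analysis.FluidPDE

namespace NoTerminalJolt

/-! ### The weak-`L²` tail bound (layer cake) -/

/-- **Weak-`L²` tail bound.** Let `f : ℝ → ℝ` be a.e.-measurable on `(a,b)`, `a < b`, and
`N > 0` with `|{τ ∈ (a,b) : λ < f(τ)}| ≤ (N/λ)²` for every `λ > 0` (`f ∈ L^{2,w}(a,b)` with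
quasi-norm `≤ N`). Then `∫⁻_{(a,b)} ofReal f ≤ ofReal (2N√(b−a))` — the weak-`L²` ⊂ `L¹` Hölder
bound on a set of finite measure, with the sharp constant `2`. Proof: layer cake for `f⁺`, the level
sets bounded by `min(b−a, N²/λ²)`, split at `λ₀ = N/√(b−a)`. [folklore] -/
theorem lintegral_ofReal_le_of_weakL2 {f : ℝ → ℝ} {a b : ℝ} (hab : a < b)
    (hf : AEMeasurable f (volume.restrict (Ioo a b))) {N : ℝ} (hN : 0 < N)
    (hweak : ∀ l : ℝ, 0 < l → volume (Ioo a b ∩ {τ | l < f τ}) ≤ ENNReal.ofReal ((N / l) ^ 2)) :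
    ∫⁻ τ in Ioo a b, ENNReal.ofReal (f τ) ≤ ENNReal.ofReal (2 * N * Real.sqrt (b - a)) := by
  set μ : Measure ℝ := volume.restrict (Ioo a b) with hμ
  set g : ℝ → ℝ := fun τ => max (f τ) 0 with hg
  have hL : 0 < b - a := sub_pos.2 hab
  have hsq : 0 < Real.sqrt (b - a) := Real.sqrt_pos.2 hL
  set l₀ : ℝ := N / Real.sqrt (b - a) with hl₀
  have hl₀0 : 0 < l₀ := div_pos hN hsq
  -- `ofReal f ≤ ofReal f⁺`, layer cake for `f⁺`
  have hg_nn : 0 ≤ᵐ[μ] g := Eventually.of_forall fun τ => le_max_right _ _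
  have hg_m : AEMeasurable g μ := hf.max aemeasurable_const
  have hle1 : ∫⁻ τ in Ioo a b, ENNReal.ofReal (f τ) ≤ ∫⁻ τ, ENNReal.ofReal (g τ) ∂μ :=
    lintegral_mono fun τ => ENNReal.ofReal_le_ofReal (le_max_left _ _)
  rw [lintegral_eq_lintegral_meas_lt μ hg_nn hg_m] at hle1
  -- the level sets
  have hlevel : ∀ l : ℝ, 0 < l → μ {τ | l < g τ} = volume (Ioo a b ∩ {τ | l < f τ}) := by
    intro l hl
    rw [hμ, Measure.restrict_apply' measurableSet_Ioo, inter_comm]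
    congr 1
    ext τ
    simp only [mem_inter_iff, mem_setOf_eq, hg, lt_max_iff, and_congr_right_iff]
    intro _
    exact ⟨fun h => h.resolve_right (not_lt.2 hl.le), fun h => Or.inl h⟩
  have hbound_low : ∀ l ∈ Ioc 0 l₀, μ {τ | l < g τ} ≤ ENNReal.ofReal (b - a) := by
    intro l hl
    rw [hlevel l hl.1]
    calc volume (Ioo a b ∩ {τ | l < f τ}) ≤ volume (Ioo a b) := measure_mono inter_subset_left
      _ = ENNReal.ofReal (b - a) := Real.volume_Ioo
  have hbound_high : ∀ l ∈ Ioi l₀, μ {τ | l < g τ} ≤ ENNReal.ofReal (N ^ 2 * l ^ (-2 : ℝ)) := by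
    intro l hl
    have hl0 : 0 < l := hl₀0.trans hl
    rw [hlevel l hl0]
    refine (hweak l hl0).trans (le_of_eq ?_)
    congr 1
    rw [div_pow, Real.rpow_neg hl0.le, show (2 : ℝ) = ((2 : ℕ) : ℝ) by norm_num, Real.rpow_natCast,
      div_eq_mul_inv]
  -- split the `λ`-integral at `λ₀`
  have hsplit : ∫⁻ l in Ioi (0 : ℝ), μ {τ | l < g τ} =
      (∫⁻ l in Ioc (0 : ℝ) l₀, μ {τ | l < g τ}) + ∫⁻ l in Ioi l₀, μ {τ | l < g τ} := by
    rw [← lintegral_union measurableSet_Ioi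
      (Set.disjoint_left.2 fun l hl hl' => absurd hl.2 (not_le.2 hl')),
      Ioc_union_Ioi_eq_Ioi hl₀0.le]
  -- low part: `≤ (b−a)·λ₀ = N√(b−a)`
  have hlow : ∫⁻ l in Ioc (0 : ℝ) l₀, μ {τ | l < g τ} ≤ ENNReal.ofReal (N * Real.sqrt (b - a)) := by
    calc ∫⁻ l in Ioc (0 : ℝ) l₀, μ {τ | l < g τ}
        ≤ ∫⁻ _ in Ioc (0 : ℝ) l₀, ENNReal.ofReal (b - a) :=
          setLIntegral_mono' measurableSet_Ioc fun l hl => hbound_low l hl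
      _ = ENNReal.ofReal (b - a) * ENNReal.ofReal l₀ := by
          rw [setLIntegral_const, Real.volume_Ioc, sub_zero, mul_comm]
      _ = ENNReal.ofReal (N * Real.sqrt (b - a)) := by
          rw [← ENNReal.ofReal_mul hL.le]
          congr 1
          rw [hl₀]
          have h := Real.mul_self_sqrt hL.le
          field_simp
          nlinarith [h]
  -- high part: `∫_{λ₀}^∞ N²/λ² dλ = N²/λ₀ = N√(b−a)`
  have hhigh : ∫⁻ l in Ioi l₀, μ {τ | l < g τ} ≤ ENNReal.ofReal (N * Real.sqrt (b - a)) := by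
    have hint : IntegrableOn (fun l : ℝ => N ^ 2 * l ^ (-2 : ℝ)) (Ioi l₀) volume :=
      (integrableOn_Ioi_rpow_of_lt (by norm_num) hl₀0).const_mul _
    have hnn : 0 ≤ᵐ[volume.restrict (Ioi l₀)] fun l : ℝ => N ^ 2 * l ^ (-2 : ℝ) :=
      (ae_restrict_mem measurableSet_Ioi).mono fun l hl =>
        mul_nonneg (sq_nonneg _) (Real.rpow_nonneg (hl₀0.trans hl).le _)
    have hval : ∫ l in Ioi l₀, N ^ 2 * l ^ (-2 : ℝ) = N * Real.sqrt (b - a) := by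
      rw [integral_const_mul, integral_Ioi_rpow_of_lt (by norm_num) hl₀0]
      have e : (-2 : ℝ) + 1 = -1 := by norm_num
      rw [e, Real.rpow_neg_one, hl₀]
      field_simp
    calc ∫⁻ l in Ioi l₀, μ {τ | l < g τ}
        ≤ ∫⁻ l in Ioi l₀, ENNReal.ofReal (N ^ 2 * l ^ (-2 : ℝ)) :=
          setLIntegral_mono' measurableSet_Ioi fun l hl => hbound_high l hl
      _ = ENNReal.ofReal (∫ l in Ioi l₀, N ^ 2 * l ^ (-2 : ℝ)) :=
          (ofReal_integral_eq_lintegral_ofReal hint hnn).symm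
      _ = ENNReal.ofReal (N * Real.sqrt (b - a)) := by rw [hval]
  calc ∫⁻ τ in Ioo a b, ENNReal.ofReal (f τ) ≤ ∫⁻ l in Ioi (0 : ℝ), μ {τ | l < g τ} := hle1
    _ = (∫⁻ l in Ioc (0 : ℝ) l₀, μ {τ | l < g τ}) + ∫⁻ l in Ioi l₀, μ {τ | l < g τ} := hsplit
    _ ≤ ENNReal.ofReal (N * Real.sqrt (b - a)) + ENNReal.ofReal (N * Real.sqrt (b - a)) :=
        add_le_add hlow hhigh
    _ = ENNReal.ofReal (2 * N * Real.sqrt (b - a)) := by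
        rw [← ENNReal.ofReal_add (by positivity) (by positivity)]; congr 1; ring

/-! ### THE WEAK-`L²` MAJORANT CRITERION -/

/-- **THE WEAK-`L²`-IN-TIME MAJORANT CRITERION.** `(u,p)` classical on `[0,T)` (`ν, T > 0`),
Leray–Hopf on `[0,T]` from a rapidly decaying datum; a majorant `‖u(τ)‖²_{L⁴} = √(∫‖u(τ)‖⁴) ≤ m(τ)`
for `τ < T` near `T`, with `m` a.e.-measurable on `(t₀,T)` (`t₀ < T`) and weakly square integrable
there: `|{τ ∈ (t₀,T) : λ < m(τ)}| ≤ (N/λ)²` for all `λ > 0` (`N > 0`). Then `∫‖u(t) − u(T)‖² → 0` as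
`t ↑ T` (no energy jump ⟺ Leray's energy equality on `[0,T]`). Proof: the weak-`L²` tail bound gives
`∫ₜˢ m ≤ 2N√(s−t) ≤ 2N√(T−t)` on every sub-slab, i.e. the `L⁴` slice-test criterion in majorant
form. Cheskidov–Luo 2020 Thm. 1.1 on the line `α = 0` (`u ∈ L^{q,w}_tL^p_x`, `2/q + 2/p = 1`), at a
first blow-up time, INCLUDING both endpoints `p = 4` and `p = ∞` (below). [folklore] -/
theorem tendsto_integral_norm_sub_sq_of_weakL2Majorant {ν T : ℝ} (hν : 0 < ν) (hT : 0 < T)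
    {u : ℝ → EuclideanSpace ℝ (Fin 3) → EuclideanSpace ℝ (Fin 3)} {p : ℝ → EuclideanSpace ℝ (Fin 3) → ℝ}
    (hcl : IsClassicalNSSolutionOn (Ico 0 T) ν 0 u p) (hLH : IsLerayHopfOn T ν 0 (u 0) u)
    (hdec : HasRapidSpatialDecay (u 0)) {m : ℝ → ℝ}
    (hm : ∀ᶠ τ in 𝓝[<] T, Real.sqrt (∫ x, ‖u τ x‖ ^ 4) ≤ m τ)
    {t₀ : ℝ} (ht₀ : t₀ < T) (hmeas : AEMeasurable m (volume.restrict (Ioo t₀ T)))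
    {N : ℝ} (hN : 0 < N)
    (hweak : ∀ l : ℝ, 0 < l → volume (Ioo t₀ T ∩ {τ | l < m τ}) ≤ ENNReal.ofReal ((N / l) ^ 2)) :
    Tendsto (fun t => ∫ x, ‖u t x - u T x‖ ^ 2) (𝓝[<] T) (𝓝 0) := by
  refine tendsto_integral_norm_sub_sq_of_l4Majorant hν hT hcl hLH hdec hm
    (by positivity : (0:ℝ) ≤ 2 * N) ?_
  filter_upwards [Ioo_mem_nhdsLT ht₀] with t htI s hs
  have hsub : Ioo t s ⊆ Ioo t₀ T := Ioo_subset_Ioo htI.1.le hs.2.le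
  have hmeas' : AEMeasurable m (volume.restrict (Ioo t s)) := hmeas.mono_set hsub
  have hweak' : ∀ l : ℝ, 0 < l → volume (Ioo t s ∩ {τ | l < m τ}) ≤ ENNReal.ofReal ((N / l) ^ 2) :=
    fun l hl => (measure_mono (inter_subset_inter_left _ hsub)).trans (hweak l hl)
  refine (lintegral_ofReal_le_of_weakL2 hs.1 hmeas' hN hweak').trans (ENNReal.ofReal_le_ofReal ?_)
  have : Real.sqrt (s - t) ≤ Real.sqrt (T - t) := Real.sqrt_le_sqrt (by linarith [hs.2])
  nlinarith

/-! ### `‖u(·)‖_{L⁴} ∈ L^{4,w}` in time ⇒ energy equality (the `β = p = 4` corner) -/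

/-- In the frame, `τ ↦ √(∫‖u(τ)‖⁴)` is a.e.-measurable on `(t,T)` for `0 ≤ t` (joint continuity of
`u` on `[0,T) × ℝ³` restricted to the measurable slab `(t,T) × ℝ³`; twin of
`aemeasurable_sqrt_integral_norm_pow_four` (closed sub-slabs), p652789). [folklore] -/
theorem aemeasurable_sqrt_integral_norm_pow_four_Ioo {ν T : ℝ}
    {u : ℝ → EuclideanSpace ℝ (Fin 3) → EuclideanSpace ℝ (Fin 3)} {p : ℝ → EuclideanSpace ℝ (Fin 3) → ℝ}
    (hcl : IsClassicalNSSolutionOn (Ico 0 T) ν 0 u p) {t : ℝ} (ht : 0 ≤ t) :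
    AEMeasurable (fun τ => Real.sqrt (∫ x, ‖u τ x‖ ^ 4)) (volume.restrict (Ioo t T)) := by
  have hsub : Ioo t T ⊆ Ico 0 T := fun τ hτ => ⟨ht.trans hτ.1.le, hτ.2⟩
  have hmeasU : AEStronglyMeasurable (uncurry u) ((volume.restrict (Ioo t T)).prod volume) := by
    rw [Measure.restrict_prod_eq_prod_univ]
    exact (hcl.smooth_velocity.continuousOn.mono (prod_mono hsub Subset.rfl)).aestronglyMeasurable
      (measurableSet_Ioo.prod MeasurableSet.univ)
  have hm : AEMeasurable (fun τ => ∫⁻ x, ‖u τ x‖ₑ ^ 4) (volume.restrict (Ioo t T)) :=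
    (hmeasU.enorm.pow_const 4).lintegral_prod_right'
  have heq : ∀ τ ∈ Ioo t T, Real.sqrt (∫ x, ‖u τ x‖ ^ 4) =
      Real.sqrt ((∫⁻ x, ‖u τ x‖ₑ ^ 4).toReal) := by
    intro τ hτ
    have hc : Continuous (u τ) := (hcl.contDiff_velocity (hsub hτ)).continuous
    have h1 : 0 ≤ᵐ[volume] fun x => ‖u τ x‖ ^ 4 :=
      Eventually.of_forall fun x => by simp only [Pi.zero_apply]; positivity
    have h2 : AEStronglyMeasurable (fun x => ‖u τ x‖ ^ 4) volume :=
      (hc.norm.pow 4).aestronglyMeasurable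
    congr 1
    rw [integral_eq_lintegral_of_nonneg_ae h1 h2]
    congr 1
    exact lintegral_congr fun x => by
      rw [← ofReal_norm, ENNReal.ofReal_pow (norm_nonneg _)]
  refine (Real.continuous_sqrt.measurable.comp_aemeasurable hm.ennreal_toReal).congr ?_
  filter_upwards [ae_restrict_mem measurableSet_Ioo] with τ hτ
  exact (heq τ hτ).symm

/-- **`‖u(·)‖_{L⁴} ∈ L^{4,w}(t₀,T)` ⇒ NO ENERGY JUMP AT `T`** (the `β = p = 4` corner of
Cheskidov–Luo, Nonlinearity 33 (2020) Thm. 1.1, excluded there by `β < p`; at a first blow-up time of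
the frame, by slice testing). `(u,p)` classical on `[0,T)` (`ν, T > 0`), Leray–Hopf on `[0,T]` from
a rapidly decaying datum, `t₀ ∈ [0,T)`, `N > 0`, and `|{τ ∈ (t₀,T) : λ < ∫‖u(τ)‖⁴}| ≤ N/λ` for every
`λ > 0` (the `L⁴` mass is weakly integrable in time — implied by Lions' `L⁴L⁴` via Chebyshev and by
the weak-`L⁴` rate `∫‖u(t)‖⁴ ≤ M/(T−t)` of p653319, and allowing INTERMITTENT versions of the latter).
Then `∫‖u(t) − u(T)‖² → 0` as `t ↑ T`. [folklore] -/
theorem tendsto_integral_norm_sub_sq_of_weakL4L4 {ν T : ℝ} (hν : 0 < ν) (hT : 0 < T)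
    {u : ℝ → EuclideanSpace ℝ (Fin 3) → EuclideanSpace ℝ (Fin 3)} {p : ℝ → EuclideanSpace ℝ (Fin 3) → ℝ}
    (hcl : IsClassicalNSSolutionOn (Ico 0 T) ν 0 u p) (hLH : IsLerayHopfOn T ν 0 (u 0) u)
    (hdec : HasRapidSpatialDecay (u 0)) {t₀ : ℝ} (ht₀ : t₀ ∈ Ico 0 T) {N : ℝ} (hN : 0 < N)
    (hweak : ∀ l : ℝ, 0 < l →
      volume (Ioo t₀ T ∩ {τ | l < ∫ x, ‖u τ x‖ ^ 4}) ≤ ENNReal.ofReal (N / l)) :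
    Tendsto (fun t => ∫ x, ‖u t x - u T x‖ ^ 2) (𝓝[<] T) (𝓝 0) := by
  refine tendsto_integral_norm_sub_sq_of_weakL2Majorant hν hT hcl hLH hdec
    (m := fun τ => Real.sqrt (∫ x, ‖u τ x‖ ^ 4)) (Eventually.of_forall fun τ => le_rfl) ht₀.2
    (aemeasurable_sqrt_integral_norm_pow_four_Ioo hcl ht₀.1) (Real.sqrt_pos.2 hN) fun l hl => ?_
  have hset : Ioo t₀ T ∩ {τ | l < Real.sqrt (∫ x, ‖u τ x‖ ^ 4)} =
      Ioo t₀ T ∩ {τ | l ^ 2 < ∫ x, ‖u τ x‖ ^ 4} := by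
    ext τ
    simp only [mem_inter_iff, mem_setOf_eq, Real.lt_sqrt hl.le]
  rw [hset]
  refine (hweak (l ^ 2) (by positivity)).trans (le_of_eq ?_)
  rw [div_pow, Real.sq_sqrt hN.le]

/-- **`eLpNorm` form** of the `L^{4,w}_tL⁴_x` criterion (the conclusion shape of the former stub
`stub_typeIIEnergyEquality`; composes with the 18118 / no-energy-atom forms as in p653319). [folklore] -/
theorem tendsto_eLpNorm_sub_of_weakL4L4 {ν T : ℝ} (hν : 0 < ν) (hT : 0 < T)
    {u : ℝ → EuclideanSpace ℝ (Fin 3) → EuclideanSpace ℝ (Fin 3)} {p : ℝ → EuclideanSpace ℝ (Fin 3) → ℝ}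
    (hcl : IsClassicalNSSolutionOn (Ico 0 T) ν 0 u p) (hLH : IsLerayHopfOn T ν 0 (u 0) u)
    (hdec : HasRapidSpatialDecay (u 0)) {t₀ : ℝ} (ht₀ : t₀ ∈ Ico 0 T) {N : ℝ} (hN : 0 < N)
    (hweak : ∀ l : ℝ, 0 < l →
      volume (Ioo t₀ T ∩ {τ | l < ∫ x, ‖u τ x‖ ^ 4}) ≤ ENNReal.ofReal (N / l)) :
    Tendsto (fun t => eLpNorm (u t - u T) 2 volume) (𝓝[<] T) (𝓝 0) :=
  (tendsto_eLpNorm_sub_iff_tendsto_integral_norm_sub_sq hT hLH).2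
    (tendsto_integral_norm_sub_sq_of_weakL4L4 hν hT hcl hLH hdec ht₀ hN hweak)

/-! ### Intermittent Type I: a sup-norm majorant in `L^{2,w}` -/

/-- **INTERMITTENT TYPE I ⇒ NO ENERGY JUMP** (Cheskidov–Luo 2020 Thm. 1.1 at `p = ∞`, `β = 2`, in the
frame). `(u,p)` classical on `[0,T)` (`ν, T > 0`), Leray–Hopf on `[0,T]` from a rapidly decaying
datum; a sup-norm majorant `‖u(τ,x)‖ ≤ b(τ)` for `τ < T` near `T` with `b` a.e.-measurable on
`(t₀,T)`, `t₀ < T`, and `|{τ ∈ (t₀,T) : λ < b(τ)}| ≤ (N/λ)²` for every `λ > 0` (`N > 0`). Then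
`∫‖u(t) − u(T)‖² → 0` as `t ↑ T`. The Type-I rate `b(τ) = C/√(T−τ)` (rev 5, Leslie–Shvydkoy 2018
Thm. 1.2) is the monotone member; here the rate may fail on a set of times of small measure.
Proof: `‖u(τ)‖²_{L⁴} ≤ b(τ)‖u(τ)‖₂ ≤ √(2E₀)·b(τ)`, and `(√(2E₀)+1)b ∈ L^{2,w}`. [folklore] -/
theorem tendsto_integral_norm_sub_sq_of_weakL2Linfty {ν T : ℝ} (hν : 0 < ν) (hT : 0 < T)
    {u : ℝ → EuclideanSpace ℝ (Fin 3) → EuclideanSpace ℝ (Fin 3)} {p : ℝ → EuclideanSpace ℝ (Fin 3) → ℝ}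
    (hcl : IsClassicalNSSolutionOn (Ico 0 T) ν 0 u p) (hLH : IsLerayHopfOn T ν 0 (u 0) u)
    (hdec : HasRapidSpatialDecay (u 0)) {b : ℝ → ℝ}
    (hub : ∀ᶠ τ in 𝓝[<] T, ∀ x, ‖u τ x‖ ≤ b τ)
    {t₀ : ℝ} (ht₀ : t₀ < T) (hbm : AEMeasurable b (volume.restrict (Ioo t₀ T)))
    {N : ℝ} (hN : 0 < N)
    (hweak : ∀ l : ℝ, 0 < l → volume (Ioo t₀ T ∩ {τ | l < b τ}) ≤ ENNReal.ofReal ((N / l) ^ 2)) :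
    Tendsto (fun t => ∫ x, ‖u t x - u T x‖ ^ 2) (𝓝[<] T) (𝓝 0) := by
  set E₀ : ℝ := VectorCalculus.kineticEnergy (u 0) with hE₀
  have hE₀0 : 0 ≤ E₀ := kineticEnergy_nonneg (u 0)
  set K : ℝ := Real.sqrt (2 * E₀) + 1 with hK
  have hK0 : 0 < K := by positivity
  have hK1 : Real.sqrt (2 * E₀) ≤ K := by rw [hK]; linarith
  -- the majorant `m = K·b`
  have hm : ∀ᶠ τ in 𝓝[<] T, Real.sqrt (∫ x, ‖u τ x‖ ^ 4) ≤ K * b τ := by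
    have hwin : ∀ᶠ t in 𝓝[<] T, t ∈ Ioo 0 T := Ioo_mem_nhdsLT hT
    filter_upwards [hub, hwin] with τ hτ hτI
    have hb0 : 0 ≤ b τ := (norm_nonneg _).trans (hτ 0)
    have hmem : MemLp (u τ) 2 volume := hLH.memLp τ ⟨hτI.1.le, hτI.2.le⟩
    have hint2 : Integrable (fun x => ‖u τ x‖ ^ 2) volume :=
      (memLp_two_iff_integrable_sq_norm hmem.1).1 hmem
    have hpt : ∀ x, ‖u τ x‖ ^ 4 ≤ b τ ^ 2 * ‖u τ x‖ ^ 2 := by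
      intro x
      have h2 : ‖u τ x‖ ^ 2 ≤ b τ ^ 2 := pow_le_pow_left₀ (norm_nonneg _) (hτ x) 2
      calc ‖u τ x‖ ^ 4 = ‖u τ x‖ ^ 2 * ‖u τ x‖ ^ 2 := by ring
        _ ≤ b τ ^ 2 * ‖u τ x‖ ^ 2 := mul_le_mul_of_nonneg_right h2 (sq_nonneg _)
    have hle : ∫ x, ‖u τ x‖ ^ 4 ≤ b τ ^ 2 * (2 * E₀) := by
      have h1 : ∫ x, ‖u τ x‖ ^ 4 ≤ ∫ x, b τ ^ 2 * ‖u τ x‖ ^ 2 :=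
        integral_mono_of_nonneg (Eventually.of_forall fun x => by positivity) (hint2.const_mul _)
          (Eventually.of_forall hpt)
      have hEt : ∫ x, ‖u τ x‖ ^ 2 = 2 * VectorCalculus.kineticEnergy (u τ) := by
        simp only [VectorCalculus.kineticEnergy]; ring
      have hanti := CertifiedBlowupAxisymBlowup.EnergyDrain.kineticEnergy_antitoneOn hν hcl hLH
        ⟨le_rfl, hT.le⟩ ⟨hτI.1.le, hτI.2.le⟩ hτI.1.le
      rw [integral_const_mul, hEt] at h1
      refine h1.trans (mul_le_mul_of_nonneg_left ?_ (sq_nonneg _))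
      simp only [hE₀] at hanti ⊢
      linarith
    calc Real.sqrt (∫ x, ‖u τ x‖ ^ 4) ≤ Real.sqrt (b τ ^ 2 * (2 * E₀)) := Real.sqrt_le_sqrt hle
      _ = b τ * Real.sqrt (2 * E₀) := by rw [Real.sqrt_mul (sq_nonneg _), Real.sqrt_sq hb0]
      _ ≤ K * b τ := by rw [mul_comm]; exact mul_le_mul_of_nonneg_right hK1 hb0
  refine tendsto_integral_norm_sub_sq_of_weakL2Majorant hν hT hcl hLH hdec hm ht₀
    (hbm.const_mul K) (mul_pos hK0 hN) fun l hl => ?_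
  have hset : Ioo t₀ T ∩ {τ | l < K * b τ} = Ioo t₀ T ∩ {τ | l / K < b τ} := by
    ext τ
    simp only [mem_inter_iff, mem_setOf_eq, div_lt_iff₀ hK0, mul_comm]
  rw [hset]
  refine (hweak (l / K) (div_pos hl hK0)).trans (le_of_eq ?_)
  congr 1
  field_simp

/-! ### The strong endpoint `L²_t L^∞_x` (Shinbrot `p = ∞`; Kozono–Taniuchi's `L²BMO` contains it) -/

/-- **`L²(t₀,T; L^∞)` ⇒ NO ENERGY JUMP** (the `p = ∞` endpoint of Shinbrot's scale, SIAM J. Math.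
Anal. 5 (1974); contained in Kozono–Taniuchi's `L²BMO` class; at a first blow-up time of the frame).
`(u,p)` classical on `[0,T)` (`ν, T > 0`), Leray–Hopf on `[0,T]` from a rapidly decaying datum; a
sup-norm majorant `‖u(τ,x)‖ ≤ b(τ)` for `τ < T` near `T` with `b` a.e.-measurable on `(t₀,T)`,
`t₀ < T`, and `∫_{t₀}^T b² < ∞`. Then `∫‖u(t) − u(T)‖² → 0` as `t ↑ T`. Proof: Chebyshev
(`meas_ge_le_lintegral_div`) puts `b` in `L^{2,w}(t₀,T)` with `N² = ∫b² + 1`, and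
`tendsto_integral_norm_sub_sq_of_weakL2Linfty` applies. Neither this class nor the Type-I rate
contains the other (`C/√(T−t) ∉ L²`); both are inside the intermittent Type-I class. [folklore] -/
theorem tendsto_integral_norm_sub_sq_of_L2Linfty {ν T : ℝ} (hν : 0 < ν) (hT : 0 < T)
    {u : ℝ → EuclideanSpace ℝ (Fin 3) → EuclideanSpace ℝ (Fin 3)} {p : ℝ → EuclideanSpace ℝ (Fin 3) → ℝ}
    (hcl : IsClassicalNSSolutionOn (Ico 0 T) ν 0 u p) (hLH : IsLerayHopfOn T ν 0 (u 0) u)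
    (hdec : HasRapidSpatialDecay (u 0)) {b : ℝ → ℝ}
    (hub : ∀ᶠ τ in 𝓝[<] T, ∀ x, ‖u τ x‖ ≤ b τ)
    {t₀ : ℝ} (ht₀ : t₀ < T) (hbm : AEMeasurable b (volume.restrict (Ioo t₀ T)))
    (hfin : ∫⁻ τ in Ioo t₀ T, ENNReal.ofReal (b τ ^ 2) ≠ ⊤) :
    Tendsto (fun t => ∫ x, ‖u t x - u T x‖ ^ 2) (𝓝[<] T) (𝓝 0) := by
  set B : ℝ := (∫⁻ τ in Ioo t₀ T, ENNReal.ofReal (b τ ^ 2)).toReal with hBdef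
  have hB0 : 0 ≤ B := ENNReal.toReal_nonneg
  set N : ℝ := Real.sqrt (B + 1) with hNdef
  have hN : 0 < N := Real.sqrt_pos.2 (by linarith)
  have hN2 : N ^ 2 = B + 1 := Real.sq_sqrt (by linarith)
  refine tendsto_integral_norm_sub_sq_of_weakL2Linfty hν hT hcl hLH hdec hub ht₀ hbm hN fun l hl => ?_
  have hF : AEMeasurable (fun τ => ENNReal.ofReal (b τ ^ 2)) (volume.restrict (Ioo t₀ T)) :=
    ENNReal.measurable_ofReal.comp_aemeasurable (hbm.pow_const 2)
  have hl2 : (0 : ℝ) < l ^ 2 := by positivity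
  -- Chebyshev on `(t₀,T)`
  have hcheb := meas_ge_le_lintegral_div hF (ENNReal.ofReal_pos.2 hl2).ne' ENNReal.ofReal_ne_top
    (μ := volume.restrict (Ioo t₀ T)) (ε := ENNReal.ofReal (l ^ 2))
  have hsub : Ioo t₀ T ∩ {τ | l < b τ} ⊆
      {τ | ENNReal.ofReal (l ^ 2) ≤ ENNReal.ofReal (b τ ^ 2)} ∩ Ioo t₀ T := by
    rintro τ ⟨hτ, hlt⟩
    refine ⟨ENNReal.ofReal_le_ofReal ?_, hτ⟩
    exact pow_le_pow_left₀ hl.le (le_of_lt hlt) 2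
  calc volume (Ioo t₀ T ∩ {τ | l < b τ})
      ≤ volume ({τ | ENNReal.ofReal (l ^ 2) ≤ ENNReal.ofReal (b τ ^ 2)} ∩ Ioo t₀ T) :=
        measure_mono hsub
    _ = volume.restrict (Ioo t₀ T) {τ | ENNReal.ofReal (l ^ 2) ≤ ENNReal.ofReal (b τ ^ 2)} :=
        (Measure.restrict_apply' measurableSet_Ioo).symm
    _ ≤ (∫⁻ τ in Ioo t₀ T, ENNReal.ofReal (b τ ^ 2)) / ENNReal.ofReal (l ^ 2) := hcheb
    _ = ENNReal.ofReal (B / l ^ 2) := by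
        rw [hBdef, ENNReal.ofReal_div_of_pos hl2, ENNReal.ofReal_toReal hfin]
    _ ≤ ENNReal.ofReal ((N / l) ^ 2) := by
        refine ENNReal.ofReal_le_ofReal ?_
        rw [div_pow, hN2]
        exact div_le_div_of_nonneg_right (by linarith) hl2.le

end NoTerminalJolt

end Summit.NavierStokesRegularity.NavierStokesRegularity.Theorems

end
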